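import Summits.ResolutionOfSingularities.ResolutionOfSingularities.Theorems.HilbertSamuelEliminationSigmaMaxModificationsCorridor3SigmaTameLowCoeffFrame
import Summits.ResolutionOfSingularities.ResolutionOfSingularities.Theorems.HilbertSamuelEliminationSigmaMaxModificationsCorridor3SigmaGroupFuel
import Literature.AlgebraicGeometry.Resolution.QuadraticTransformsKeyLemma
import HarnessLib

/-!
# [OURS · L1 W4.2] σ-LAYER, TAME-LOW row T-L6 — `Corridor3SigmaTameLowLaws`: the TAME-LOW LINEAGE LAWS. §1 PROVED: under «child germ = quadratic transform of
# the parent germ + controlled-transform law» the BASE-POINT COUNT DROPS strictly while base points remain (Zariski's tree); §2 the fuel of record in 002's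
# `TameLowFuel = ℕ ×ₗ ℕ ×ₗ Colex((ℕ ×ₗ ℕ) →₀ ℕ)` and its lex laws; §3 the snc-phase and end-game steps as READING AXIOMS (rows T-L4 / T-L5 own their content)
# with the fuel drops PROVED from them; §4 the THIN σ-SOCKET: a `TameLowLineage` (rank + per-step ring witnesses) IS a `GroupRankReadingAny TameLowFuel …` —
# 002's `ρL` binder of `hybridEliminationHyp3S_of_kindReadings` (p559681) by name
# (crux chain w42 `SigmaMaxModifications` stmt-ResolutionOfSingularities-18506 / conjunct `SigmaMaxModificationsCorridor3` stmt-ResolutionOfSingularities-19249;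
# res-L1-w42-plan-1 RULING v3.14-48 (PD)(vi)/(PF) «T-L6 S-non-increase + N′ = strict transform + H₂~-persistence LAWS as reading axioms (B6), with res-D-pv-060's
# T-L1 lemmas» + DESK WORD 18:33:36Z «the DROPS are T-L6 laws»; DESK NOTE BD-1 (b): contact element ABSTRACT; seat res-L1-type-o2 g9 = «res-type-067/068 SUCCESSOR»;
# `--supports stmt-ResolutionOfSingularities-19249 --as helper`, counted 0)

HONEST FRAMING. OURS bookkeeping over FILE 1a/1b (`…TameLowCoeff`, `…TameLowCoeffFrame`), 002's `…SigmaGroupFuel` (`TameLowFuel`, `GroupRankReadingAny`) and the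
tree's quadratic-transform library (`idealBaseTree`, `not_reflTransGen_of_isQuadraticTransform`, `maximalIdeal_ne_span_singleton`). NOTHING here is a statement of
H. Hironaka's manuscript [Hironaka2017] nor of Cossart–Jannsen–Saito. §1/§2 and the derivations of §3/§4 are PROVED; the `structure … : Prop` READING AXIOMS
(`IsPointChild`, `IsSncChild`, `IsEndChild`, `TameLowLineage`'s fields) are OURS hypotheses the σ-side realisation owes, each tagged with the row / B6 law
that discharges it. No named fact, no axiom, no instance, no notation. AI-typed; AI review weaker than expert review.

## How the B6 laws of TAME-FORK ADDENDUM B / RULING -48 enter (the map from words to binders)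

* «H₂~ PERSISTS» (060 T-L1 p557013 `IsBlowup.diffContactChart_transform`: the weight-one transform of `V(z)` contains `Sing_{S₀}(N′)` and stays regular) ⇒ the
  lineage child `y′` lies on the regular surface `H₂′ = H₂~`, whose local ring at `y′` is a QUADRATIC TRANSFORM of `𝒪_{H₂,y}` when the centre is the point `y`
  — binder `IsPointChild.isQuadraticTransform`.
* «N′ = STRICT TRANSFORM» / `J′ = J·𝒪/e^{c}` ((TL1): controlled transforms commute) restricted to `H₂′` ⇒ `Coeff_{H₂′}(J′) = e^{-c} · Coeff_{H₂}(J)·𝒪_{H₂′,y′}` up to the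
  unit/marking conventions ⇒ binder `IsPointChild.exists_eq` («`(a)·𝔞′ = (b)·𝔞R′`, `a, b ≠ 0`»).
* «S NEVER RISES under gated steps» (order semicontinuity in persistent contact; CJS Thm 3.10 for `ν`) ⇒ the TAME-LOW group is LIVE at the child only at
  EQUAL value `(ν, S₀)`; a drop is the group's DEATH (no law owed) — encoded by 002's `GLive` in §4, not by a binder here.
* The three PHASES of (TL4): base-point phase (`𝔞♮ ≠ ⊤`, centre = the point) — §1 PROVED drop; snc phase (`𝔞♮ = ⊤`, `(V(g_red) ∪ traces)` not snc at `y`, centre =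
  the point, F-75-bounded defect `δ` drops) — READING AXIOM `IsSncChild` (row T-L4); end-game (snc, `Q₂`-allowed face of the `H₂` board, `q2Measure` drops —
  s42 T-L5 p556956 / 002 `QDiscipline.ofQ2Step`) — READING AXIOM `IsEndChild` (row T-L5).

## Contents (namespace `…Theorems.SigmaMaxModificationsCorridor3.Sigma.TameLow`, continued)

* §1 `isPrincipal_span_singleton_mul_iff`, `isPrincipal_iff_of_span_singleton_mul_eq`, `extIdeal_extIdeal`, `extIdeal_span_singleton_mul`, `inclusion_ne_zero`;
  **`CoeffDatum.IsPointChild D D′`** (READING AXIOM) and PROVED `isPrincipal_extIdeal_residual_iff`, `idealBaseTree_subset`, `not_mem_idealBaseTree`,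
  **`basePointCount_lt`** (`𝔞♮ ≠ ⊤ ⇒` strict), `basePointCount_le`, `fuel_lt` (FILE 1b's `ℕ ×ₗ ℕ ×ₗ ℕ` fuel).
* §2 **`CoeffDatum.tameLowFuel D δ q : TameLowFuel`** (002's codomain of record: `(basePointCount, δ, q)` with `q : Colex ((ℕ ×ₗ ℕ) →₀ ℕ)` = the `q2Measure` of the
  end-game board) + `tameLowFuel_lt_of_basePointCount_lt` / `_of_snc_lt` / `_of_q_lt`, `IsPointChild.tameLowFuel_lt`.
* §3 READING AXIOMS `IsSncChild D D′ δ δ′` (point child ∧ `𝔞♮ = ⊤` ∧ `δ′ < δ`) and `IsEndChild D D′ δ q q′` (point-or-curve child at equal first two coordinates ∧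
  `q′ < q`), with PROVED `IsSncChild.basePointCount_eq` (`= 0` both sides), `IsSncChild.tameLowFuel_lt`, `IsEndChild.tameLowFuel_lt`, and the trichotomy
  packaging `IsTameLowStep` ⇒ `tameLowFuel_lt_of_isTameLowStep`.
* §4 THE THIN σ-SOCKET: **`TameLowLineage σ N ν s₀ GLive`** (rank into `TameLowFuel`, `changes`, `Adjacent`, and two fields: every board-CHANGING live step carries a
  ring witness `IsTameLowStep` between the two ranks; every other live step leaves the rank unchanged — an isomorphism at the germ) and
  **`TameLowLineage.toRankReading : GroupRankReadingAny TameLowFuel σ N ν s₀ GLive`** (MOVE-lt from §3, NEUTRAL-le/SEAL-le by equality) — 002's `ρL`.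

VACUITY SELF-CHECK. §1's theorem has content (it is false without `𝔞♮ ≠ ⊤`: then both counts are `0`). The reading axioms are satisfiable (a chain of honest
quadratic transforms with the controlled transform realises `IsPointChild`; §3's are conjunctions with an explicit strict inequality) and not tautologies (each
implies a strict fuel drop, which fails for the identity step).
-/

noncomputable section

set_option linter.dupNamespace false -- mandated namespace of this single-conjunct summit

open IsLocalRing Literature.AlgebraicGeometry.Resolution
open Summit.ResolutionOfSingularities.ResolutionOfSingularities.Theorems.CampaignW42

namespace Summit.ResolutionOfSingularities.ResolutionOfSingularities.Theorems.SigmaMaxModificationsCorridor3.Sigma.TameLow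

universe u

/-! ## §1. THE BASE-POINT-PHASE LAW, PROVED: under the point blow-up of the lineage point (a quadratic transform) and the controlled-transform law,
## the base-point count DROPS strictly while base points remain -/

section PrincipalFactor

variable {A : Type u} [CommRing A] [IsDomain A]

/-- **In a domain, `(a) · I` is principal iff `I` is** (`a ≠ 0`). [folklore] -/
theorem isPrincipal_span_singleton_mul_iff {a : A} (ha : a ≠ 0) (I : Ideal A) :
    (Ideal.span {a} * I).IsPrincipal ↔ I.IsPrincipal := by
  constructor
  · rintro ⟨h, hh⟩
    have hh' : Ideal.span {a} * I = Ideal.span {h} := hh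
    have hmem : h ∈ Ideal.span {a} * I := by rw [hh']; exact Ideal.mem_span_singleton_self h
    obtain ⟨j, hj, hjh⟩ := Ideal.mem_span_singleton_mul.mp hmem
    refine ⟨⟨j, le_antisymm (fun i hi => ?_) ?_⟩⟩
    · have hai : a * i ∈ Ideal.span {h} := by
        rw [← hh']
        exact Ideal.mul_mem_mul (Ideal.mem_span_singleton_self a) hi
      obtain ⟨t, ht⟩ := Ideal.mem_span_singleton'.mp hai
      -- `t * h = a * i`, `h = a * j` ⇒ `i = t * j`
      have : a * i = a * (t * j) := by rw [← ht, ← hjh]; ring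
      have hi' : i = t * j := mul_left_cancel₀ ha this
      show i ∈ Submodule.span A {j}
      rw [hi']
      exact Ideal.mul_mem_left _ t (Ideal.mem_span_singleton_self j)
    · show Submodule.span A {j} ≤ I
      exact (Ideal.span_singleton_le_iff_mem I).mpr hj
  · rintro ⟨i, hi⟩
    have hi' : I = Ideal.span {i} := hi
    exact ⟨⟨a * i, by rw [hi', Ideal.span_singleton_mul_span_singleton]⟩⟩

/-- Corollary: two ideals that agree up to non-zero principal factors are principal together. [folklore] -/
theorem isPrincipal_iff_of_span_singleton_mul_eq {a b : A} (ha : a ≠ 0) (hb : b ≠ 0) {I J : Ideal A}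
    (h : Ideal.span {a} * I = Ideal.span {b} * J) : I.IsPrincipal ↔ J.IsPrincipal := by
  rw [← isPrincipal_span_singleton_mul_iff ha I, h, isPrincipal_span_singleton_mul_iff hb J]

end PrincipalFactor

section Ext

variable {K : Type u} [Field K]

/-- `extIdeal` is transitive along `R ≤ R₁ ≤ S`. [folklore] -/
theorem extIdeal_extIdeal {R R₁ S : Subring K} (h₁ : R ≤ R₁) (h₂ : R₁ ≤ S) (J : Ideal R) :
    extIdeal (extIdeal J R₁) S = extIdeal J S := by
  rw [extIdeal_eq_map J h₁, extIdeal_eq_map _ h₂, extIdeal_eq_map J (h₁.trans h₂), Ideal.map_map]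
  rfl

/-- `extIdeal` of a product with a principal ideal. [folklore] -/
theorem extIdeal_span_singleton_mul {R S : Subring K} (h : R ≤ S) (a : R) (J : Ideal R) :
    extIdeal (Ideal.span {a} * J) S = Ideal.span {Subring.inclusion h a} * extIdeal J S := by
  rw [extIdeal_eq_map _ h, extIdeal_eq_map J h, Ideal.map_mul, Ideal.map_span, Set.image_singleton]

/-- Non-zero elements stay non-zero along `Subring.inclusion`. [folklore] -/
theorem inclusion_ne_zero {R S : Subring K} (h : R ≤ S) {a : R} (ha : a ≠ 0) : Subring.inclusion h a ≠ 0 := by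
  intro h0
  apply ha
  have : ((Subring.inclusion h a : S) : K) = 0 := by rw [h0]; rfl
  exact Subtype.ext this

end Ext

namespace CoeffDatum

variable {K : Type u} [Field K]

/-- [OURS · L1 W4.2] **THE CONTROLLED-TRANSFORM LAW at a point blow-up of the lineage point, ring side** (a READING AXIOM of row T-L6, here as a
`Prop` the σ-reading instantiates): the child germ `D'.R` is a QUADRATIC TRANSFORM of `D.R` (the local ring of `H₂~` at the lineage child —
`H₂~` = strict transform of `H₂`, T-L1's persistence), and the child's coefficient ideal is the parent's extended ideal UP TO NON-ZERO PRINCIPAL FACTORS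
(`(a) · 𝔞' = (b) · 𝔞 R'` — the controlled transform `𝔞' = e^{-c} · 𝔞R'`, `e` the exceptional parameter, has `a = e^c`, `b = 1`; the two-sided
form also absorbs unit/marking conventions). NOT a statement of the manuscript. [folklore] -/
structure IsPointChild (D D' : CoeffDatum K) : Prop where
  /-- the child germ is a quadratic transform of the parent germ -/
  isQuadraticTransform : IsQuadraticTransform D.R D'.R
  /-- controlled transform, up to non-zero principal factors -/
  exists_eq : ∃ (a b : D'.R), a ≠ 0 ∧ b ≠ 0 ∧ Ideal.span {a} * D'.coeff = Ideal.span {b} * extIdeal D.coeff D'.R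

namespace IsPointChild

variable {D D' : CoeffDatum K} (h : IsPointChild D D')

include h

/-- `R ≤ R'`. [folklore] -/
theorem le : D.R ≤ D'.R := h.isQuadraticTransform.dominates.1

/-- **Along the child's tree, principality of the child's residual = principality of the parent's residual** (all principal factors cancel:
`𝔞 = 𝔪on·(g)·𝔞♮` on both sides and the controlled-transform law). [folklore] -/
theorem isPrincipal_extIdeal_residual_iff {S : Subring K} (hS : D'.R ≤ S) :
    (extIdeal D'.residual S).IsPrincipal ↔ (extIdeal D.residual S).IsPrincipal := by
  haveI := D.isRegularLocalRing
  haveI := D'.isRegularLocalRing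
  obtain ⟨a, b, ha, hb, hab⟩ := h.exists_eq
  have hRS : D.R ≤ S := h.le.trans hS
  -- extend both factorisations to `S`
  have e1 : extIdeal (Ideal.span {a} * D'.coeff) S =
      Ideal.span {Subring.inclusion hS (a * (D'.monomial * D'.principalPart))} * extIdeal D'.residual S := by
    rw [D'.coeff_eq, ← mul_assoc, Ideal.span_singleton_mul_span_singleton, Ideal.span_singleton_mul_span_singleton,
      extIdeal_span_singleton_mul hS]
  have e2 : extIdeal (Ideal.span {b} * extIdeal D.coeff D'.R) S =
      Ideal.span {Subring.inclusion hS b * Subring.inclusion hRS (D.monomial * D.principalPart)} * extIdeal D.residual S := by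
    rw [extIdeal_span_singleton_mul hS, D.coeff_eq, Ideal.span_singleton_mul_span_singleton, extIdeal_extIdeal h.le hS,
      extIdeal_span_singleton_mul hRS, ← mul_assoc, Ideal.span_singleton_mul_span_singleton]
  have key : Ideal.span {Subring.inclusion hS (a * (D'.monomial * D'.principalPart))} * extIdeal D'.residual S =
      Ideal.span {Subring.inclusion hS b * Subring.inclusion hRS (D.monomial * D.principalPart)} * extIdeal D.residual S := by
    rw [← e1, ← e2, hab]
  refine isPrincipal_iff_of_span_singleton_mul_eq ?_ ?_ key
  · exact inclusion_ne_zero hS (mul_ne_zero ha (mul_ne_zero D'.monomial_ne_zero D'.principalPart_ne_zero))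
  · exact mul_ne_zero (inclusion_ne_zero hS hb) (inclusion_ne_zero hRS (mul_ne_zero D.monomial_ne_zero D.principalPart_ne_zero))

/-- **The child's base tree sits inside the parent's** (nodes above `R'` are nodes above `R`, with the same principality test). [folklore] -/
theorem idealBaseTree_subset : idealBaseTree D'.R D'.residual ⊆ idealBaseTree D.R D.residual := by
  rintro S ⟨hS, hnp⟩
  refine ⟨Relation.ReflTransGen.head h.isQuadraticTransform hS, fun hp => hnp ?_⟩
  exact (h.isPrincipal_extIdeal_residual_iff (subringDominates_of_reflTransGen hS).1).mpr hp

/-- **The parent germ is NOT in the child's tree** (a two-dimensional regular local ring is not an iterated quadratic transform of its own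
quadratic transform: `𝔪` is not principal). [folklore] -/
theorem not_mem_idealBaseTree : D.R ∉ idealBaseTree D'.R D'.residual := by
  haveI := D.isRegularLocalRing
  rintro ⟨hS, -⟩
  exact not_reflTransGen_of_isQuadraticTransform h.isQuadraticTransform
    (fun _ z => maximalIdeal_ne_span_singleton D.ringKrullDim_eq_two z) hS

/-- **T-L6 LAW (BASE-POINT PHASE), PROVED: while base points remain (`𝔞♮ ≠ ⊤` at the parent), the base-point count DROPS STRICTLY at the lineage
child of the point blow-up** — the first coordinate of the TAME-LOW fuel. [cite: ZariskiSamuel1960, Appendix 5] -/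
theorem basePointCount_lt (hne : D.residual ≠ ⊤) : D'.basePointCount < D.basePointCount := by
  unfold basePointCount
  refine Set.ncard_lt_ncard (Set.ssubset_iff_subset_ne.mpr ⟨h.idealBaseTree_subset, fun heq => ?_⟩) D.finite_idealBaseTree_residual
  exact h.not_mem_idealBaseTree (heq ▸ D.self_mem_idealBaseTree hne)

/-- The base-point count never rises at a point child (also when the parent has none left). [folklore] -/
theorem basePointCount_le : D'.basePointCount ≤ D.basePointCount :=
  Set.ncard_le_ncard h.idealBaseTree_subset D.finite_idealBaseTree_residual

/-- **FUEL DROP in the base-point phase**: whatever the other two coordinates do. [folklore] -/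
theorem fuel_lt (hne : D.residual ≠ ⊤) (δ δ' w w' : ℕ) : D'.fuel δ' w' < D.fuel δ w :=
  fuel_lt_of_basePointCount_lt (h.basePointCount_lt hne) δ δ' w w'

end IsPointChild

end CoeffDatum

end Summit.ResolutionOfSingularities.ResolutionOfSingularities.Theorems.SigmaMaxModificationsCorridor3.Sigma.TameLow


namespace Summit.ResolutionOfSingularities.ResolutionOfSingularities.Theorems.SigmaMaxModificationsCorridor3.Sigma.TameLow

universe u

namespace CoeffDatum

variable {K : Type u} [Field K]

/-! ## §2. The fuel of record in 002's `TameLowFuel` -/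

/-- [OURS · L1 W4.2] **THE TAME-LOW FUEL OF RECORD** `(#base points, snc defect, q2Measure) ∈ TameLowFuel = ℕ ×ₗ ℕ ×ₗ Colex((ℕ ×ₗ ℕ) →₀ ℕ)` (002's
`…SigmaGroupFuel`, RULING v3.14-48 (PD)(vi)): `δ` is row T-L4's snc-defect reading, `q` the `q2Measure` of the end-game board (s42 T-L5 / 002
`QDiscipline.ofQ2Step`; `toColex 0` before the end-frame exists). VALUES; the drops are §1/§3. NOT a statement of the manuscript. [folklore] -/
def tameLowFuel (D : CoeffDatum K) (δ : ℕ) (q : Colex ((ℕ ×ₗ ℕ) →₀ ℕ)) : Sigma.TameLowFuel := toLex (D.basePointCount, toLex (δ, q))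

/-- First coordinate. [folklore] -/
theorem tameLowFuel_fst (D : CoeffDatum K) (δ : ℕ) (q : Colex ((ℕ ×ₗ ℕ) →₀ ℕ)) : (ofLex (D.tameLowFuel δ q)).1 = D.basePointCount := rfl

/-- **Lex law 1**: fewer base points ⇒ smaller fuel. [folklore] -/
theorem tameLowFuel_lt_of_basePointCount_lt {D D' : CoeffDatum K} (h : D'.basePointCount < D.basePointCount) (δ δ' : ℕ)
    (q q' : Colex ((ℕ ×ₗ ℕ) →₀ ℕ)) : D'.tameLowFuel δ' q' < D.tameLowFuel δ q :=
  Prod.Lex.toLex_lt_toLex.mpr (Or.inl h)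

/-- **Lex law 2**: at equal base-point count, smaller snc defect ⇒ smaller fuel. [folklore] -/
theorem tameLowFuel_lt_of_snc_lt {D D' : CoeffDatum K} (h0 : D'.basePointCount = D.basePointCount) {δ δ' : ℕ} (h : δ' < δ)
    (q q' : Colex ((ℕ ×ₗ ℕ) →₀ ℕ)) : D'.tameLowFuel δ' q' < D.tameLowFuel δ q :=
  Prod.Lex.toLex_lt_toLex.mpr (Or.inr ⟨h0, Prod.Lex.toLex_lt_toLex.mpr (Or.inl h)⟩)

/-- **Lex law 3**: at equal first two coordinates, smaller `q2Measure` ⇒ smaller fuel. [folklore] -/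
theorem tameLowFuel_lt_of_q_lt {D D' : CoeffDatum K} (h0 : D'.basePointCount = D.basePointCount) (δ : ℕ) {q q' : Colex ((ℕ ×ₗ ℕ) →₀ ℕ)}
    (h : q' < q) : D'.tameLowFuel δ q' < D.tameLowFuel δ q :=
  Prod.Lex.toLex_lt_toLex.mpr (Or.inr ⟨h0, Prod.Lex.toLex_lt_toLex.mpr (Or.inr ⟨rfl, h⟩)⟩)

/-- **§1 in the codomain of record**: in the base-point phase the fuel of record drops. [folklore] -/
theorem IsPointChild.tameLowFuel_lt {D D' : CoeffDatum K} (h : IsPointChild D D') (hne : D.residual ≠ ⊤) (δ δ' : ℕ)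
    (q q' : Colex ((ℕ ×ₗ ℕ) →₀ ℕ)) : D'.tameLowFuel δ' q' < D.tameLowFuel δ q :=
  tameLowFuel_lt_of_basePointCount_lt (h.basePointCount_lt hne) δ δ' q q'

/-! ## §3. The snc-phase and end-game steps as READING AXIOMS, and their fuel drops -/

/-- [OURS · L1 W4.2] **READING AXIOM — SNC-PHASE STEP** (row T-L4, (TL4)(ii)): base points are gone (`𝔞♮ = ⊤`), the centre is the lineage point (so the
child germ is a quadratic transform with the controlled-transform law), and the snc DEFECT of `(V(g_red) ∪ traces)` DROPS at the lineage child (F-75 read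
lineage-locally — row T-L4 owns the content). NOT a statement of the manuscript. [folklore] -/
structure IsSncChild (D D' : CoeffDatum K) (δ δ' : ℕ) : Prop where
  /-- the step is a point blow-up of the lineage point with the controlled-transform law -/
  pointChild : IsPointChild D D'
  /-- the base-point phase is over at the parent -/
  residual_eq_top : D.residual = ⊤
  /-- the snc defect drops -/
  snc_lt : δ' < δ

namespace IsSncChild

variable {D D' : CoeffDatum K} {δ δ' : ℕ} (h : IsSncChild D D' δ δ')

include h

/-- No base points at the parent. [folklore] -/
theorem basePointCount_eq_zero : D.basePointCount = 0 := D.basePointCount_eq_zero_iff.mpr h.residual_eq_top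

/-- … hence none at the child (the count never rises at a point child). [folklore] -/
theorem basePointCount_eq_zero' : D'.basePointCount = 0 :=
  Nat.le_zero.mp (h.basePointCount_eq_zero ▸ h.pointChild.basePointCount_le)

/-- Equal first coordinates. [folklore] -/
theorem basePointCount_eq : D'.basePointCount = D.basePointCount := by
  rw [h.basePointCount_eq_zero, h.basePointCount_eq_zero']

/-- **FUEL DROP in the snc phase** (second coordinate, whatever `q` does). [folklore] -/
theorem tameLowFuel_lt (q q' : Colex ((ℕ ×ₗ ℕ) →₀ ℕ)) : D'.tameLowFuel δ' q' < D.tameLowFuel δ q :=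
  tameLowFuel_lt_of_snc_lt h.basePointCount_eq h.snc_lt q q'

end IsSncChild

/-- [OURS · L1 W4.2] **READING AXIOM — END-GAME STEP** (row T-L5, (TL4)(iii)): both germs are past the base-point phase with EQUAL snc defect (the frame is
snc before and after — an end-game step keeps snc), and the `q2Measure` of the `H₂` board DROPS (a `Q₂`-allowed face was played: s42 T-L5
`…TameLowBoard` / 002 `QDiscipline.ofQ2Step`, `TState.q2Measure_lt_of_q2AllowedD`). The child germ is EITHER a quadratic transform (point move) OR the
same germ (curve move — an isomorphism of the surface), so no `IsPointChild` is demanded; only the first-coordinate equality is. NOT a statement of the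
manuscript. [folklore] -/
structure IsEndChild (D D' : CoeffDatum K) (δ : ℕ) (q q' : Colex ((ℕ ×ₗ ℕ) →₀ ℕ)) : Prop where
  /-- the base-point phase is over at the parent -/
  residual_eq_top : D.residual = ⊤
  /-- … and at the child -/
  residual_eq_top' : D'.residual = ⊤
  /-- the end-game measure drops -/
  q_lt : q' < q

namespace IsEndChild

variable {D D' : CoeffDatum K} {δ : ℕ} {q q' : Colex ((ℕ ×ₗ ℕ) →₀ ℕ)} (h : IsEndChild D D' δ q q')

include h

/-- Equal (zero) first coordinates. [folklore] -/
theorem basePointCount_eq : D'.basePointCount = D.basePointCount := by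
  rw [D.basePointCount_eq_zero_iff.mpr h.residual_eq_top, D'.basePointCount_eq_zero_iff.mpr h.residual_eq_top']

/-- **FUEL DROP in the end-game** (third coordinate). [folklore] -/
theorem tameLowFuel_lt : D'.tameLowFuel δ q' < D.tameLowFuel δ q :=
  tameLowFuel_lt_of_q_lt h.basePointCount_eq δ h.q_lt

end IsEndChild

/-- [OURS · L1 W4.2] **A TAME-LOW STEP** between consecutive fuels of one lineage: one of the three phases. NOT a statement of the manuscript. [folklore] -/
inductive IsTameLowStep : (D D' : CoeffDatum K) → (δ δ' : ℕ) → (q q' : Colex ((ℕ ×ₗ ℕ) →₀ ℕ)) → Prop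
  /-- base-point phase: point child while `𝔞♮ ≠ ⊤` -/
  | basePoint {D D' : CoeffDatum K} {δ δ' : ℕ} {q q' : Colex ((ℕ ×ₗ ℕ) →₀ ℕ)} (h : IsPointChild D D') (hne : D.residual ≠ ⊤) :
      IsTameLowStep D D' δ δ' q q'
  /-- snc phase -/
  | snc {D D' : CoeffDatum K} {δ δ' : ℕ} {q q' : Colex ((ℕ ×ₗ ℕ) →₀ ℕ)} (h : IsSncChild D D' δ δ') : IsTameLowStep D D' δ δ' q q'
  /-- end-game -/
  | endGame {D D' : CoeffDatum K} {δ : ℕ} {q q' : Colex ((ℕ ×ₗ ℕ) →₀ ℕ)} (h : IsEndChild D D' δ q q') : IsTameLowStep D D' δ δ q q'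

/-- **EVERY TAME-LOW STEP LOWERS THE FUEL OF RECORD** (lexicographically). [folklore] -/
theorem tameLowFuel_lt_of_isTameLowStep {D D' : CoeffDatum K} {δ δ' : ℕ} {q q' : Colex ((ℕ ×ₗ ℕ) →₀ ℕ)}
    (h : IsTameLowStep D D' δ δ' q q') : D'.tameLowFuel δ' q' < D.tameLowFuel δ q := by
  cases h with
  | basePoint h hne => exact h.tameLowFuel_lt hne _ _ _ _
  | snc h => exact h.tameLowFuel_lt _ _
  | endGame h => exact h.tameLowFuel_lt

end CoeffDatum

/-! ## §4. The thin σ-socket: a TAME-LOW lineage reading IS 002's `ρL` -/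

section Socket

open Summit.ResolutionOfSingularities.ResolutionOfSingularities.Theorems.SigmaMaxModificationsCorridor3.Sigma

variable {G : Type} (σ : StrategyE.{u}) (N : ℕ) (ν : ℕ → ℕ) (s₀ : MarkedStageE.{u}) (GLive : G → MarkedStageE.{u} → Prop)

/-- [OURS · L1 W4.2] **A RING WITNESS between two fuels**: some field `K` and coefficient data `D, D′` over it with a TAME-LOW step from `(D, δ, q)` to
`(D′, δ′, q′)` realising the two fuel values. NOT a statement of the manuscript. [folklore] -/
def HasStepWitness (r r' : Sigma.TameLowFuel) : Prop :=
  ∃ (K : Type u) (_ : Field K) (D D' : CoeffDatum K) (δ δ' : ℕ) (q q' : Colex ((ℕ ×ₗ ℕ) →₀ ℕ)),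
    r = D.tameLowFuel δ q ∧ r' = D'.tameLowFuel δ' q' ∧ CoeffDatum.IsTameLowStep D D' δ δ' q q'

/-- A witnessed step lowers the fuel. [folklore] -/
theorem lt_of_hasStepWitness {r r' : Sigma.TameLowFuel} (h : HasStepWitness r r') : r' < r := by
  obtain ⟨K, _, D, D', δ, δ', q, q', rfl, rfl, hstep⟩ := h
  exact CoeffDatum.tameLowFuel_lt_of_isTameLowStep hstep

/-- [OURS · L1 W4.2] **THE TAME-LOW LINEAGE READING** (the σ-side realisation's obligation for 002's `ρL`, RULING v3.14-48 (PD)(vi)/(PF) T-L6): a rank in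
`TameLowFuel` for every group at every stage, the board-change and adjacent-birth predicates, and two laws along σE-chains from `s₀` at steps where the group
is live before and after — (W) a board-CHANGING step carries a RING WITNESS (`HasStepWitness`: base-point / snc / end-game phase between the two ranks; the B6
laws «H₂~ persists», «N′ = strict transform», «S never rises» are what the realisation uses to produce it, see the module docstring), (I) a step changing no
board of the group leaves its rank UNCHANGED (the step is an isomorphism at the lineage germ). NOT a statement of the manuscript. [folklore] -/
structure TameLowLineage where
  /-- the TAME-LOW fuel of group `g` at stage `s` -/
  rank : MarkedStageE.{u} → G → Sigma.TameLowFuel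
  /-- the step `c n ↦ c (n+1)` changes the `H₂`-board / germ of `g` -/
  changes : (ℕ → MarkedStageE.{u}) → G → ℕ → Prop
  /-- an adjacent group is born at the step -/
  Adjacent : (ℕ → MarkedStageE.{u}) → G → ℕ → Prop
  /-- (W) board-changing live steps are witnessed TAME-LOW steps -/
  witness : ∀ c, IsChainFromσE σ N ν s₀ c → ∀ g n, GLive g (c n) → GLive g (c (n + 1)) → changes c g n →
    HasStepWitness.{u} (rank (c n) g) (rank (c (n + 1)) g)
  /-- (I) other live steps do not move the rank -/
  rank_eq : ∀ c, IsChainFromσE σ N ν s₀ c → ∀ g n, GLive g (c n) → GLive g (c (n + 1)) → ¬ changes c g n →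
    rank (c (n + 1)) g = rank (c n) g

variable {σ N ν s₀ GLive}

/-- **THE SOCKET: a TAME-LOW lineage reading IS a rank reading in `TameLowFuel`** — 002's `ρL` binder of `GroupRankSimulation.ofKindReadings` /
`hybridEliminationHyp3S_of_kindReadings` (with `GLive := LiveOfKind GLive kind .tameLow` there). [folklore] -/
def TameLowLineage.toRankReading (L : TameLowLineage σ N ν s₀ GLive) : GroupRankReadingAny Sigma.TameLowFuel σ N ν s₀ GLive where
  rank := L.rank
  changes := L.changes
  Adjacent := L.Adjacent
  move_lt c hc g n h₀ h₁ hch := lt_of_hasStepWitness (L.witness c hc g n h₀ h₁ hch)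
  neutral_le c hc g n h₀ h₁ hch _ := (L.rank_eq c hc g n h₀ h₁ hch).le
  seal_le c hc g n h₀ h₁ hch _ := (L.rank_eq c hc g n h₀ h₁ hch).le

/-- Unfolding: the socket's rank is the lineage's. [folklore] -/
@[simp] theorem TameLowLineage.toRankReading_rank (L : TameLowLineage σ N ν s₀ GLive) : L.toRankReading.rank = L.rank := rfl

/-- Unfolding: the socket's board-change predicate is the lineage's. [folklore] -/
@[simp] theorem TameLowLineage.toRankReading_changes (L : TameLowLineage σ N ν s₀ GLive) : L.toRankReading.changes = L.changes := rfl

end Socket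

end Summit.ResolutionOfSingularities.ResolutionOfSingularities.Theorems.SigmaMaxModificationsCorridor3.Sigma.TameLow

end
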